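import Literature.Probability.Percolation.ArmSeparationRawGoodUp
import HarnessLib

/-!
# Tips of opposite colours on a common side: the gaps given by the protections

Topic `Literature/Probability/Percolation`; family `crit-perc` / near-critical percolation on `𝕋`.
A brick of the near-critical arm-separation theorem for four arms in the ADJACENT colour
arrangement (P. Nolin, EJP 13 (2008), Thm. 11, `j = 4`, `σ = BBWW` [arXiv 0711.4948: Thm. 10];
the input `hsepAdj` of `Werner2009_lemma63_of_altSeparation_of_adjSeparation`).

An exit of one colour and an exit of the other colour may lie behind the same side of `∂Λ_{2M}`.
The tip of a term FROM BELOW is protected from above (`TrapRawOK.no_escape`: no path of the other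
colour in the trapezoid from a site of `Tp ∪ J_{>z}` in the `8k`-box about the tip to outside the
`16k`-box), the tip of a term FROM ABOVE is protected from below (`TrapRawOKUp.no_escape_below`).
A crossing of the trapezoid of the other colour ending at a tip `z'` is such a path (it starts on
the inner side `{v₀ = M + 1}`, outside the `16k`-box when `16k + 1 ≤ M`). Hence:

* `tip_gap_above` — a protected tip from below and a tip of the other colour ABOVE it are more than
  `8k` apart;
* `tip_gap_below` — a protected tip from above and a tip of the other colour BELOW it are more than
  `8k` apart.

(In the two remaining relative positions — the other tip below a tip from below, or above a tip from
above — no gap holds: the lowest open crossing and the highest closed crossing under it are the two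
sides of one interface. There the exterior structures of the two exits point away from each other.)

Everything here is proved; no named facts are introduced.

## References

* P. Nolin, Near-critical percolation in two dimensions, *Electron. J. Probab.* 13 (2008), §4.2
  Def. 6 (free spaces), §4.4 proof of Lemma 15 (arXiv 0711.4948: Def. 6, Lemma 14) [Nolin2008].
-/

noncomputable section

open Set

namespace Literature.Probability.Percolation

open LatticeModels

/-- **A protected tip from below and a tip of the other colour above it are `> 8k` apart.** Let `c`
(tip `z`, open in `ω`) be raw-good at scale `k ≥ 1` with `16k + 1 ≤ M`, and let `c'` be a crossing of
the trapezoid closed in `ω` with tip `z'` above `z`. Then `z₁ + 8k < z'₁`. [cite: Nolin2008, §4.4 Lemma 15 (proof) (arXiv 0711.4948: Lemma 14)] -/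
theorem tip_gap_above {M k : ℕ} {c c' : Finset (Site 2)} {z z' : Site 2} {ω : SiteConfig (Site 2)}
    (h : TrapRawOK M c z k ω) (hk : 1 ≤ k) (hkM : 16 * k + 1 ≤ M) (hc : (trapDomain M).IsCrossing c z)
    (hcω : (↑c : Set (Site 2)) ⊆ ω) (hc' : (trapDomain M).IsCrossing c' z') (hc'ω : (↑c' : Set (Site 2)) ⊆ ωᶜ)
    (hlt : z 1 < z' 1) : z 1 + 8 * k < z' 1 := by
  by_contra hle
  rw [not_lt] at hle
  obtain ⟨hz0, hz1, hz1'⟩ := trapO_coord (tip_mem_trapO hc)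
  have hz'O : z' ∈ trapO M := tip_mem_trapO hc'
  obtain ⟨hz'0, -, -⟩ := trapO_coord hz'O
  obtain ⟨f, hfc', hfI⟩ := hc'.exists_start
  have hf0 := (mem_trapI.1 hfI).2
  have hpath : PathIn triGraph ((↑(trapD M) : Set (Site 2)) ∩ ωᶜ) z' f :=
    (hc'.conn z' hc'.tip_mem f hfc').mono fun v hv => ⟨Finset.mem_coe.2 (hc'.subset hv), hc'ω hv⟩
  refine h.no_escape hk hc hcω (q := z') (t := f) (Finset.mem_union_right _ (mem_trapDomain_Jabove.2 ⟨hz'O, hlt⟩))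
    ⟨by omega, by omega, by omega, hle⟩ (Or.inl ?_) hpath
  omega

/-- **A protected tip from above and a tip of the other colour below it are `> 8k` apart.** Let `d`
(tip `z`, open in `ω`) be raw-good FROM ABOVE at scale `k ≥ 1` with `16k + 1 ≤ M`, and let `c'` be a
crossing of the trapezoid closed in `ω` with tip `z'` below `z`. Then `z'₁ + 8k < z₁`. [cite: Nolin2008, §4.4 Lemma 15 (proof) (arXiv 0711.4948: Lemma 14)] -/
theorem tip_gap_below {M k : ℕ} {d c' : Finset (Site 2)} {z z' : Site 2} {ω : SiteConfig (Site 2)}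
    (h : TrapRawOKUp M d z k ω) (hk : 1 ≤ k) (hkM : 16 * k + 1 ≤ M) (hd : (trapDomain M).flip.IsCrossing d z)
    (hdω : (↑d : Set (Site 2)) ⊆ ω) (hc' : (trapDomain M).IsCrossing c' z') (hc'ω : (↑c' : Set (Site 2)) ⊆ ωᶜ)
    (hlt : z' 1 < z 1) : z' 1 + 8 * k < z 1 := by
  by_contra hle
  rw [not_lt] at hle
  have hd' : (trapDomain M).IsCrossing d z := (JDomain.flip_isCrossing_iff _).1 hd
  obtain ⟨hz0, hz1, hz1'⟩ := trapO_coord (tip_mem_trapO hd')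
  have hz'O : z' ∈ trapO M := tip_mem_trapO hc'
  obtain ⟨hz'0, -, -⟩ := trapO_coord hz'O
  obtain ⟨f, hfc', hfI⟩ := hc'.exists_start
  have hf0 := (mem_trapI.1 hfI).2
  have hpath : PathIn triGraph ((↑(trapD M) : Set (Site 2)) ∩ ωᶜ) z' f :=
    (hc'.conn z' hc'.tip_mem f hfc').mono fun v hv => ⟨Finset.mem_coe.2 (hc'.subset hv), hc'ω hv⟩
  refine h.no_escape_below hk hd hdω (q := z') (t := f) (Finset.mem_union_right _ (mem_trapDomain_Jbelow.2 ⟨hz'O, hlt⟩))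
    ⟨by omega, by omega, by omega, by omega⟩ (Or.inl ?_) hpath
  omega

end Literature.Probability.Percolation
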